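import Literature.RepresentationTheory.FiniteGroups.SymmetricGroupCharacterEvaluation
import HarnessLib

/-!
# Ikenmeyer–Panova 2017, Prop. 5.2 (stretched hooks): kernel computations of the base cases (A)

Sibling computations file (D-0014; theorems only, no definitions, no named facts) of
`Literature/Computability/AlgebraicComplexity/IP17KroneckerPositivity.lean` (the named fact
`ikenmeyerPanova2017_prop_5_2`) and of its proofs file `IP17KroneckerPositivityProofs.lean`, which
discharges that fact by the PRINTED proof of C. Ikenmeyer, G. Panova, Adv. Math. 319 (2017) 40–66 =
arXiv:1512.03798v2, Prop. 5.2 (TeX L1231–1262): hook positivity, the semigroup property, growth of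
the frame, and finitely many base Kronecker coefficients. The printed base cases are Kronecker
coefficients of `𝔖_98`, `𝔖_147` ("finite calculations for `i = 2, 3` and `m = 7`", "initial condition
computationally verified for `(a,b) = (7,7)`"), out of reach of kernel certification; the proofs file
replaces them by SMALLER frames from which the printed moves (frame growth, resp. the induction of the
printed Claim on `(a, b)`) reach every case of the proposition. This file certifies those smaller
coefficients in the kernel with the verified evaluator of
`Literature/RepresentationTheory/FiniteGroups/SymmetricGroupCharacterEvaluation.lean`
(`MNEval.kronSum`: `n! · g(λ, μ, ν) = kronSum n λ μ ν`, `kroneckerCoeff_pos_iff_kronSum_pos`), each by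
`decide` in the kernel, exactly as the tree's `OccurrenceObstructionsIPComputations*.lean` do for IP §4:

* (the base cases for `k ∈ {1, 2, 4, 6}` of the printed proof — bodies `(2^k)`, `(3^k)` against small
  frames — are ALREADY certified in the tree, among the computations for IP Thm. 4.6:
  `Literature.Computability.Complexity.ipcComp_2_2_1` (`(2,2)`/`2×2`), `ipcComp_2_3_1` (`(2,2,2)`/`2×3`),
  `ipcComp_3_4_9` (`(4,2⁴)`/`3×4`), `ipcComp_3_5_11` (`(3,2⁶)`/`3×5`), `ipcComp_3_3_1` (`(6,3)`/`3×3`),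
  `ipcComp_3_3_6` (`(3³)`/`3×3`), `ipcComp_3_5_8` (`(3⁵)`/`3×5`), `ipcComp_4_6_1` (`(6,3⁶)`/`4×6`); nothing is
  recomputed here);
* the transposed triples `μ^i[a,b] = ((ab-r)^i, 1^{ir})` against `(ia) × b` and `a × (bi)` of the
  printed Claim, for `i = 2`: `(a,b) = (2,2)`, `r ∈ {1, 2}` (`𝔖_8`) and `(a,b) = (3,3)`, `r ∈ {4, 6}`
  (`𝔖_18`) — the base of the induction on `(a, b)` for the four large legs
  `k ∈ {m²-7, m²-5, m²-3, m²-2}` (`r = m² - 1 - k ∈ {6, 4, 2, 1}`). The `i = 3` bases (`𝔖_27`) are the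
  sibling files `IP17StretchedHookComputationsB1`–`B4`.

Also the bookkeeping lemma `sum_map_eq_sum_range_chunks` (a mapped list sum as the sum of the sums of
consecutive chunks), used to split a class sum so that each kernel evaluation stays within memory.

## References

* C. Ikenmeyer, G. Panova, *Rectangular Kronecker coefficients and plethysms in geometric complexity
  theory*, Adv. Math. 319 (2017) 40–66 = arXiv:1512.03798v2, Prop. 5.2 and its proof (TeX
  L1231–1262; held text `paper:arxiv-1512.03798`: Proposition 25, chunk p0013). [key `IkenmeyerPanova2017`]

## Mathlib and tree

Mathlib: `List.take_append_drop`, `List.drop_drop`, `Finset.sum_range_succ'`, `decide +kernel`.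
Tree: `MNEval.kronSum`, `MNEval.kronTerm`, `MNEval.cycleTypes` (`SymmetricGroupCharacterEvaluation`).
-/

open scoped BigOperators

namespace Literature.Computability.AlgebraicComplexity

open Literature.RepresentationTheory.FiniteGroups.MNEval (kronSum kronTerm cycleTypes)

/-! ### Splitting a class sum into consecutive chunks -/

/-- A mapped list sum is the sum, over `j < K`, of the sums of the consecutive chunks
`l[cj, cj + c)`, as soon as `cK ≥ |l|` — the bookkeeping by which the class sums `n!·g(λ, μ, ν)` of the
printed "finite calculations" are split so that each kernel evaluation stays within memory (list
plumbing for those computations, no mathematical content of its own).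
[cite: IkenmeyerPanova2017, Prop. 5.2 (proof: the computed base cases; TeX L1246–1248)] -/
theorem sum_map_eq_sum_range_chunks {α : Type*} (f : α → ℤ) (c : ℕ) :
    ∀ (K : ℕ) (l : List α), l.length ≤ c * K →
      (l.map f).sum = ∑ j ∈ Finset.range K, (((l.drop (c * j)).take c).map f).sum
  | 0, l, h => by
    have hl : l = [] := List.eq_nil_of_length_eq_zero (Nat.le_zero.mp (by simpa using h))
    simp [hl]
  | K + 1, l, h => by
    rw [Finset.sum_range_succ', Nat.mul_zero, List.drop_zero]
    conv_lhs => rw [← List.take_append_drop c l, List.map_append, List.sum_append]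
    have h' : (l.drop c).length ≤ c * K := by
      rw [List.length_drop, Nat.mul_succ] at *
      omega
    rw [add_comm, sum_map_eq_sum_range_chunks f c K (l.drop c) h']
    congr 1
    refine Finset.sum_congr rfl fun j _ => ?_
    rw [List.drop_drop, Nat.mul_succ, Nat.add_comm]

/-! ### The transposed Claim triples `μ²[a,b]` against `(2a) × b`, `a × (2b)` (base of the induction, `i = 2`) -/

set_option maxHeartbeats 100000000 in
set_option maxRecDepth 100000 in
/-- Claim base `i = 2`, `(a,b) = (2,2)`, `r = 1`: `g((3,3,1,1), (2⁴), (4,4)) = 1`: `0 < kronSum 8 [3, 3, 1, 1] [2, 2, 2, 2] [4, 4]`, i.e. the Kronecker coefficient is positive (`kroneckerCoeff_pos_iff_kronSum_pos`), by the verified evaluator in the kernel. [cite: IkenmeyerPanova2017, Prop. 5.2 (proof, base cases "finite calculations … give positive values" / "initial condition computationally verified"; TeX L1231–1262; held: Proposition 25, chunk p0013)] -/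
theorem ipsh_kronSum_mu2_22_r1 : 0 < kronSum 8 [3, 3, 1, 1] [2, 2, 2, 2] [4, 4] := by
  decide +kernel

set_option maxHeartbeats 100000000 in
set_option maxRecDepth 100000 in
/-- Claim base `i = 2`, `(a,b) = (2,2)`, `r = 2`: `g((2,2,1⁴), (2⁴), (4,4)) = 1`: `0 < kronSum 8 [2, 2, 1, 1, 1, 1] [2, 2, 2, 2] [4, 4]`, i.e. the Kronecker coefficient is positive (`kroneckerCoeff_pos_iff_kronSum_pos`), by the verified evaluator in the kernel. [cite: IkenmeyerPanova2017, Prop. 5.2 (proof, base cases "finite calculations … give positive values" / "initial condition computationally verified"; TeX L1231–1262; held: Proposition 25, chunk p0013)] -/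
theorem ipsh_kronSum_mu2_22_r2 : 0 < kronSum 8 [2, 2, 1, 1, 1, 1] [2, 2, 2, 2] [4, 4] := by
  decide +kernel

set_option maxHeartbeats 100000000 in
set_option maxRecDepth 100000 in
/-- Claim base `i = 2`, `(a,b) = (3,3)`, `r = 4`: `g((5,5,1⁸), (3⁶), (6³)) = 3`: `0 < kronSum 18 [5, 5, 1, 1, 1, 1, 1, 1, 1, 1] [3, 3, 3, 3, 3, 3] [6, 6, 6]`, i.e. the Kronecker coefficient is positive (`kroneckerCoeff_pos_iff_kronSum_pos`), by the verified evaluator in the kernel. [cite: IkenmeyerPanova2017, Prop. 5.2 (proof, base cases "finite calculations … give positive values" / "initial condition computationally verified"; TeX L1231–1262; held: Proposition 25, chunk p0013)] -/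
theorem ipsh_kronSum_mu2_33_r4 : 0 < kronSum 18 [5, 5, 1, 1, 1, 1, 1, 1, 1, 1] [3, 3, 3, 3, 3, 3] [6, 6, 6] := by
  decide +kernel

set_option maxHeartbeats 100000000 in
set_option maxRecDepth 100000 in
/-- Claim base `i = 2`, `(a,b) = (3,3)`, `r = 6`: `g((3,3,1¹²), (3⁶), (6³)) = 2`: `0 < kronSum 18 [3, 3, 1, 1, 1, 1, 1, 1, 1, 1, 1, 1, 1, 1] [3, 3, 3, 3, 3, 3] [6, 6, 6]`, i.e. the Kronecker coefficient is positive (`kroneckerCoeff_pos_iff_kronSum_pos`), by the verified evaluator in the kernel. [cite: IkenmeyerPanova2017, Prop. 5.2 (proof, base cases "finite calculations … give positive values" / "initial condition computationally verified"; TeX L1231–1262; held: Proposition 25, chunk p0013)] -/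
theorem ipsh_kronSum_mu2_33_r6 : 0 < kronSum 18 [3, 3, 1, 1, 1, 1, 1, 1, 1, 1, 1, 1, 1, 1] [3, 3, 3, 3, 3, 3] [6, 6, 6] := by
  decide +kernel

end Literature.Computability.AlgebraicComplexity
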